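import Summits.CriticalPhenomena.PercolationContinuityZ3.Theorems.FK.ThetaIdentification
import Summits.CriticalPhenomena.PercolationContinuityZ3.Theorems.FK.InfiniteVolumeMeasures
import Summits.CriticalPhenomena.PercolationContinuityZ3.Theorems.FK.FreeWiredCriticalPoint
import Summits.CriticalPhenomena.PercolationContinuityZ3.Theorems.FK.ContinuityTargets
import HarnessLib

/-!
# FK-continuity cell, FO-07 (part 3 of 3): `φ^b_{p,q}(|C(0)| = ∞) = θ^b(p,q)` for the canonical limits
# `rcLimit d b p q`; the infinite-volume meaning of `rcCriticalProb` ((5.2), both `b`) and of the targets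

Helper file of the `fk-continuity` build cell (bschramm lane; `--supports stmt-CriticalPhenomena-4575`),
row FO-07 of `run/shared/lean/prim/bschramm/fk-continuity/FANOUT-PLAN.md`; builds on p205010 (kernel
theorem, internal audit signed; external expert review pending). No definitions, no named facts, no
sorries; standard axioms.

Part 2 (`ThetaIdentification.lean`) proved `P(|C(0)| = ∞) = θ⁰(p,q)` / `θ¹(p,q)` for every free / wired
box limit `P` (Grimmett 2006 (5.1), Prop. (5.11)), abstractly over `IsBoxLimit`; part 1
(`FreeWiredCriticalPoint.lean`) proved (5.3) for `θ⁰` and (5.4) `p_c⁰ = p_c¹ = rcCriticalProb d q`. This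
part plugs in 06b's existence theorem `isBoxLimit_rcLimit` (`InfiniteVolumeMeasures.lean`, Grimmett
Thm. (4.19)(a)). For `0 ≤ p ≤ 1`, `q ≥ 1`:

* `rcLimit_false/true_real_percolatesAt` — `(rcLimit d b p q)(|C(0)| = ∞) = θ^b(p,q)` for 06b's
  canonical limits (`isBoxLimit_rcLimit`); the arm-probability forms;
* `rcCriticalProb_eq_sSup_rcLimit_true/false` — **(5.2) in infinite volume, both boundary
  conditions**: `rcCriticalProb d q = sup {p ∈ [0,1] : φ^b_{p,q}(|C(0)| = ∞) = 0}` for `b = 1` AND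
  `b = 0`;
* `rcLimit_percolatesAt_eq_zero_iff_lt_rcCriticalProb` — (5.3) in infinite volume, off `p_c(q)`;
* `fkContinuityFree_iff_rcLimit`, `fkContinuityWired_iff_rcLimit` — the cell's targets
  `FKContinuityFree/Wired d q` (`ContinuityTargets.lean`: `θ⁰/θ¹(p_c(q),q) = 0`) say exactly that
  `φ⁰/φ¹_{p_c(q),q}` has almost surely no infinite cluster at the origin.

## References

* G. Grimmett, *The Random-Cluster Model*, Springer 2006: §5.1 (5.1)–(5.4) p. 98, Prop. (5.11) p. 99,
  Thm. (5.16)(b), Conj. (6.32)(a). [Grimmett2006]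
-/

noncomputable section

open MeasureTheory Set Filter
open scoped Topology ENNReal

namespace Summit.CriticalPhenomena.PercolationContinuityZ3.Theorems.FK

open Literature.Probability.Percolation Literature.Probability.LatticeModels
open Literature.Barriers.CriticalPhenomena

variable {d : ℕ}

/-! ### 1. The canonical limits `rcLimit d b p q` -/

section Canonical

variable {p q : ℝ}

/-- **`φ⁰_{p,q}(|C(0)| = ∞) = θ⁰(p,q)`** for the canonical free limit `rcLimit d false p q`
(`0 ≤ p ≤ 1`, `q ≥ 1`). [cite: Grimmett2006, §5.1 (5.1)] -/
theorem rcLimit_false_real_percolatesAt (hp : p ∈ Set.Icc (0 : ℝ) 1) (hq : 1 ≤ q) :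
    (rcLimit d false p q).real (percolatesAt (0 : Site d)) = thetaFree d p q :=
  (isBoxLimit_rcLimit false hp hq).real_percolatesAt_eq_thetaFree hp hq

/-- **`φ¹_{p,q}(|C(0)| = ∞) = θ¹(p,q)`** for the canonical wired limit `rcLimit d true p q`
(`0 ≤ p ≤ 1`, `q ≥ 1`). [cite: Grimmett2006, §5.1 (5.1) and Prop. (5.11)] -/
theorem rcLimit_true_real_percolatesAt (hp : p ∈ Set.Icc (0 : ℝ) 1) (hq : 1 ≤ q) :
    (rcLimit d true p q).real (percolatesAt (0 : Site d)) = thetaWired d p q :=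
  (isBoxLimit_rcLimit true hp hq).real_percolatesAt_eq_thetaWired hp hq

/-- Both at once: `(rcLimit d b p q)(|C(0)| = ∞) = θ^b(p,q)`. [cite: Grimmett2006, §5.1 (5.1)] -/
theorem rcLimit_real_percolatesAt (b : Bool) (hp : p ∈ Set.Icc (0 : ℝ) 1) (hq : 1 ≤ q) :
    (rcLimit d b p q).real (percolatesAt (0 : Site d)) =
      (bif b then thetaWired d p q else thetaFree d p q) :=
  (isBoxLimit_rcLimit b hp hq).real_percolatesAt_eq hp hq

/-- `φ⁰_{p,q}(0 ↔ ∂Λ_n) = thetaFreeArm d p q n` for the canonical free limit.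
[cite: Grimmett2006, Thm. (4.19)(a) and §5.1 (5.1)] -/
theorem rcLimit_false_real_siteToBoundary (hp : p ∈ Set.Icc (0 : ℝ) 1) (hq : 1 ≤ q) (n : ℕ) :
    (rcLimit d false p q).real (siteToBoundary d n) = thetaFreeArm d p q n :=
  (isBoxLimit_rcLimit false hp hq).real_siteToBoundary_eq_thetaFreeArm hp hq n

/-- `θ¹(p,q) ≤ φ¹_{p,q}(0 ↔ ∂Λ_n) ≤ φ¹_{Λ_n,p,q}(0 ↔ ∂Λ_n)` for the canonical wired limit.
[cite: Grimmett2006, Prop. (5.11) (proof)] -/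
theorem rcLimit_true_real_siteToBoundary_mem_Icc (hp : p ∈ Set.Icc (0 : ℝ) 1) (hq : 1 ≤ q) (n : ℕ) :
    (rcLimit d true p q).real (siteToBoundary d n) ∈
      Set.Icc (thetaWired d p q) (thetaWiredBox d p q n) :=
  ⟨(isBoxLimit_rcLimit true hp hq).thetaWired_le_real_siteToBoundary hp hq n,
    (isBoxLimit_rcLimit true hp hq).real_siteToBoundary_le_thetaWiredBox hp hq n⟩

/-! ### 2. Meaning of `rcCriticalProb` and of the cell's targets in infinite volume -/

/-- **(5.2) with `b = 1`, in infinite volume**: the tree's `rcCriticalProb d q` is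
`sup {p ∈ [0,1] : φ¹_{p,q}(|C(0)| = ∞) = 0}` (`q ≥ 1`). [cite: Grimmett2006, §5.1 (5.1)–(5.2)] -/
theorem rcCriticalProb_eq_sSup_rcLimit_true (d : ℕ) {q : ℝ} (hq : 1 ≤ q) :
    rcCriticalProb d q =
      sSup {p : ℝ | p ∈ Set.Icc (0 : ℝ) 1 ∧ (rcLimit d true p q).real (percolatesAt (0 : Site d)) = 0} := by
  unfold rcCriticalProb
  congr 1
  ext p
  simp only [Set.mem_setOf_eq]
  constructor
  · rintro ⟨hp, h0⟩
    exact ⟨hp, by rwa [rcLimit_true_real_percolatesAt hp hq]⟩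
  · rintro ⟨hp, h0⟩
    exact ⟨hp, by rwa [← rcLimit_true_real_percolatesAt hp hq]⟩

/-- **(5.2) with `b = 0` and (5.4), in infinite volume**: `rcCriticalProb d q` is ALSO
`sup {p ∈ [0,1] : φ⁰_{p,q}(|C(0)| = ∞) = 0}` — the free critical point (`q ≥ 1`; part 1's
`sSup_thetaFree_eq_zero_eq_rcCriticalProb`). [cite: Grimmett2006, §5.1 (5.1)–(5.4)] -/
theorem rcCriticalProb_eq_sSup_rcLimit_false (d : ℕ) {q : ℝ} (hq : 1 ≤ q) :
    rcCriticalProb d q =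
      sSup {p : ℝ | p ∈ Set.Icc (0 : ℝ) 1 ∧ (rcLimit d false p q).real (percolatesAt (0 : Site d)) = 0} := by
  rw [← sSup_thetaFree_eq_zero_eq_rcCriticalProb d hq]
  congr 1
  ext p
  simp only [Set.mem_setOf_eq]
  constructor
  · rintro ⟨hp, h0⟩
    exact ⟨hp, by rwa [rcLimit_false_real_percolatesAt hp hq]⟩
  · rintro ⟨hp, h0⟩
    exact ⟨hp, by rwa [← rcLimit_false_real_percolatesAt hp hq]⟩

/-- **(5.3) in infinite volume**: for `p ∈ [0,1]`, `p ≠ p_c(q)` (`q ≥ 1`) and either boundary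
condition `b`, `φ^b_{p,q}(|C(0)| = ∞) = 0 ↔ p < p_c(q)`. [cite: Grimmett2006, §5.1 (5.3)–(5.4)] -/
theorem rcLimit_percolatesAt_eq_zero_iff_lt_rcCriticalProb (b : Bool) {q : ℝ} (hq : 1 ≤ q)
    (hp : p ∈ Set.Icc (0 : ℝ) 1) (hne : p ≠ rcCriticalProb d q) :
    rcLimit d b p q (percolatesAt (0 : Site d)) = 0 ↔ p < rcCriticalProb d q := by
  haveI := isProbabilityMeasure_rcLimit b p q (d := d)
  rw [← measureReal_eq_zero_iff, rcLimit_real_percolatesAt b hp hq]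
  cases b
  · exact thetaFree_eq_zero_iff_lt_rcCriticalProb_of_ne hq hp hne
  · exact thetaWired_eq_zero_iff_lt_rcCriticalProb_of_ne hq hp hne

/-- **Meaning of the cell's deciding target T_F**: `FKContinuityFree d q` (`θ⁰(p_c(q),q) = 0`,
`ContinuityTargets.lean`) says exactly that the free infinite-volume measure at the critical point has
almost surely no infinite cluster at the origin (`q ≥ 1`). [cite: Grimmett2006, §5.1 (5.1) and Conj. (6.32)(a)] -/
theorem fkContinuityFree_iff_rcLimit (d : ℕ) {q : ℝ} (hq : 1 ≤ q) :
    FKContinuityFree d q ↔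
      rcLimit d false (rcCriticalProb d q) q (percolatesAt (0 : Site d)) = 0 := by
  haveI := isProbabilityMeasure_rcLimit false (rcCriticalProb d q) q (d := d)
  rw [fkContinuityFree_iff, ← measureReal_eq_zero_iff,
    rcLimit_false_real_percolatesAt (rcCriticalProb_mem_Icc d q) hq]

/-- **Meaning of the target T_W**: `FKContinuityWired d q` (`θ¹(p_c(q),q) = 0`) says exactly that the
wired infinite-volume measure at the critical point has almost surely no infinite cluster at the origin
(`q ≥ 1`). [cite: Grimmett2006, §5.1 (5.1) and Thm. (5.16)(b)] -/
theorem fkContinuityWired_iff_rcLimit (d : ℕ) {q : ℝ} (hq : 1 ≤ q) :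
    FKContinuityWired d q ↔
      rcLimit d true (rcCriticalProb d q) q (percolatesAt (0 : Site d)) = 0 := by
  haveI := isProbabilityMeasure_rcLimit true (rcCriticalProb d q) q (d := d)
  rw [fkContinuityWired_iff, ← measureReal_eq_zero_iff,
    rcLimit_true_real_percolatesAt (rcCriticalProb_mem_Icc d q) hq]

end Canonical

end Summit.CriticalPhenomena.PercolationContinuityZ3.Theorems.FK

end
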